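import Literature.AlgebraicGeometry.HodgeTheory.SkewVanishingLattice
import Summits.HodgeConjecture.HodgeConjecture.Theorems.LinearSystemTorelliLocalTubeSpanFrameLiftBasic
import Summits.HodgeConjecture.HodgeConjecture.Theorems.LinearSystemTorelliLocalTubeSpanPlaneCalculus
import Summits.HodgeConjecture.HodgeConjecture.Theorems.LinearSystemTorelliLocalTubeSpanUnimodularTransitivityLemmas
import Summits.HodgeConjecture.HodgeConjecture.Theorems.LinearSystemTorelliLocalTubeSpanPlaneEuclid
import Summits.HodgeConjecture.HodgeConjecture.Theorems.LinearSystemTorelliLocalTubeSpanTransvectionIdentities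
import Summits.HodgeConjecture.HodgeConjecture.Theorems.LinearSystemTorelliLocalTubeSpanSp2Closure
import Summits.HodgeConjecture.HodgeConjecture.Theorems.LinearSystemTorelliLocalTubeSpanOrthogonalPartnersSquare
import Summits.HodgeConjecture.HodgeConjecture.Theorems.LinearSystemTorelliLocalTubeSpanPartnersGenerate
import Summits.HodgeConjecture.HodgeConjecture.Theorems.LinearSystemTorelliLocalTubeSpanPairMoves
import Summits.HodgeConjecture.HodgeConjecture.Theorems.LinearSystemTorelliLocalTubeSpanUnimodularTransitivityLocal
import Summits.HodgeConjecture.HodgeConjecture.Theorems.LinearSystemTorelliLocalTubeSpanLatticeCoordinates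
import Summits.HodgeConjecture.HodgeConjecture.Theorems.LinearSystemTorelliLocalTubeSpanThreeSquares
import Summits.HodgeConjecture.HodgeConjecture.Theorems.LinearSystemTorelliLocalTubeSpanPrimitiveMem
import Summits.HodgeConjecture.HodgeConjecture.Theorems.LinearSystemTorelliLocalTubeSpanSquaresStep
import Summits.HodgeConjecture.HodgeConjecture.Theorems.LinearSystemTorelliLocalTubeSpanSquaresPeel
import Summits.HodgeConjecture.HodgeConjecture.Theorems.LinearSystemTorelliLocalTubeSpanSquaresStrip
import Summits.HodgeConjecture.HodgeConjecture.Theorems.LinearSystemTorelliLocalTubeSpanDescent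
import Summits.HodgeConjecture.HodgeConjecture.Theorems.LinearSystemTorelliLocalTubeSpanThm29
import Mathlib.Tactic.Module
import Summits.HodgeConjecture.HodgeConjecture.Theorems.LinearSystemTorelliLocalTubeSpanUniStar
import Summits.HodgeConjecture.HodgeConjecture.Theorems.LinearSystemTorelliLocalTubeSpanTheoremU
import Summits.HodgeConjecture.HodgeConjecture.Theorems.LinearSystemTorelliLocalTubeSpanSquaresAll
import Summits.HodgeConjecture.HodgeConjecture.Theorems.LinearSystemTorelliLocalTubeSpanBetaPairOdd

/-!
# Line `Sketch` of crux `LocalTubeSpan` (stmt-HodgeConjecture-2490) — cycles 8–9 (lead c7): DISCHARGING JANSSEN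

Companion skeleton to `Lines/Sketch.lean` (cycles 1–7, 170 KB; the combined file exceeds the 200 KB workfile cap,
so the Janssen cycles live here).  Stubs `stub_*` are the registered units of work; `sorry` only in open stubs.
See `Lines/Sketch.md` §CYCLE 8 / §CYCLE 9 and the crux `NOTES.md`.
-/

set_option linter.dupNamespace false

noncomputable section

open Literature.AlgebraicGeometry.HodgeTheory
open Summit.HodgeConjecture.HodgeConjecture.Theorems

namespace Summit.HodgeConjecture.HodgeConjecture.Cruxes.LocalTubeSpan.SketchJanssen

/-! ## Cycle 8 (continuation lead c7) — DISCHARGING JANSSEN: Theorem 2.9 UNCONDITIONALLY, Lemma 2.7, and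
Theorem 2.5 reduced to its residual (stabiliser) form

After cycle 7 the line rests on `Janssen1983_thm2_5` alone (`Γ_Δ ⊇ Sp♯₂(ℤΔ)`).  Cycle 8 attacks the
fact itself.  Write `M = ℤΔ`, `Γ = Γ_Δ`, `K = Sp♯₂(M)` (the four hypotheses of `Janssen1983_thm2_5` on a
unit `g`), and fix a unimodular pair `u, w ∈ Δ` (`⟨u, w⟩ = 1`), `P = ℤu ⊕ ℤw`, `N = P^⊥ ∩ M`,
`N_w = {n ∈ N : w + n ∈ Δ}`.

* `stub_planeEuclid` (worker A1) — Euclid in `⟨T_u, T_w⟩`: every lattice vector is moved into `u^⊥`.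
* `stub_partnersGenerate` (worker A2) — JANSSEN'S LEMMA 2.7, unconditionally: `M` is generated by `u`
  and the partners `{δ ∈ Δ : ⟨u, δ⟩ = 1}` of `u` (the sublattice they span is `Γ`-stable: for
  `ε ∈ Δ ∩ u^⊥`, `T_ε` maps partners to partners; a general `ε ∈ Δ` is conjugated into `u^⊥` by A1).
* `stub_transvectionIdentities` (worker B) — the transvection calculus behind the cycle:
  `T_{kd+a} T_{kd-a} = T_a² T_d^{2k²}` (`a ⟂ d`), the composite of the `-1`'s of the planes `(u, w)` and
  `(u, w + n)` is the pair move `E_{u,n}²`, and the Heisenberg composition law along an isotropic vector.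
* `stub_pairMovesOfPartners` (worker C) — granting Lemma 2.7 at `u`: for EVERY `m ∈ M ∩ u^⊥` some
  element of `Γ` acts as `E_{u,m}² : v ↦ v + 2(⟨v,u⟩m + ⟨v,m⟩u)` (for `n ∈ N_w` it is the product of the
  six squares `T_u²T_w²T_{u+w}² · T_u²T_{w+n}²T_{u+w+n}²`; these `n` generate `N` by Lemma 2.7; the
  Heisenberg law closes under sums).
* `stub_unimodularTransitivityLocal` (worker D) — cycle 7's unimodular transitivity with LOCAL
  hypotheses: pair moves only at `e ∈ {x, y}` and squares only at `a ∈ {x, y, x + y}` (all its proof uses).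
* `stub_sp2Closure` (worker K) — the four `Sp♯₂` conditions are closed under products and inverses and
  hold for the moves `T_a²`, `E_{e,f}²`.
* `stub_orthogonalPartnersSquare` (worker P) — `u, δ, δ' ∈ Δ`, `⟨u,δ⟩ = ⟨u,δ'⟩ = 1`, `⟨δ, δ'⟩ = 0` ⟹
  some element of `Γ` acts as `T_{δ'-δ}²` (the four-letter identity
  `T_{w+n} T_w⁻¹ T_{w-n} T_w⁻¹ = T_n²` for `w ⟂ n`, with `w - n = -(-1_{(u,w)})(w + n) ∈ Δ`).
* LEAD: `stub_descent` — every `g ∈ K` is `h · g'` with `h ∈ Γ ∩ K` and `g'` FIXING `u` AND `w`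
  (transitivity D with the moves C inside the subgroup `Γ ⊓ K`, then `T_u^{2β}` and `E_{u,-m}²`); and
  `stub_residual` — THE HARDEST, open in general: an element of `K` fixing `u` and `w` lies in `Γ`
  (`= id_P ⊕ γ`, `γ ∈ Sp♯₂(N)`; trivial when `B|_N = 0`; for `N/rad` unimodular it is `T_m² ∈ Γ ∀ m ∈ N`;
  for non-unimodular `N` it needs non-unipotent stabiliser elements — evidence `work/compute/`).

COMPOSITIONS: `janssen_thm2_9 : Janssen1983_thm2_9` — UNCONDITIONAL (A2 + C twice + D + squares of
`T_δ, T_y, T_{δ+y}`); `janssen_thm2_5_of_residual : (residual) → Janssen1983_thm2_5` (descent).  Hence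
the star basis, the companions and every "granting 2.9" statement of cycles 4–7 hold outright, and the
line's remaining arithmetic input is the RESIDUAL alone.
-/

section Cycle8Janssen

variable {V : Type} [AddCommGroup V] [Module ℚ V]

/-- stub (cycle 8, worker A1): EUCLID IN A UNIMODULAR PENCIL.  If units `tu, tw` act as the
transvections `T_u, T_w` of an alternating form with `⟨u, w⟩ = 1`, then every `ε` with integral
pairings `⟨u, ε⟩, ⟨w, ε⟩` is moved into `u^⊥` by some element of `⟨tu, tw⟩`
(`T_w^k : ⟨u,ε⟩ ↦ ⟨u,ε⟩ + k⟨w,ε⟩`, `T_u^j : ⟨w,ε⟩ ↦ ⟨w,ε⟩ - j⟨u,ε⟩`; Euclid on `|⟨u,ε⟩| + |⟨w,ε⟩|`). -/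
theorem stub_planeEuclid (B : LinearMap.BilinForm ℚ V) (hB : B.IsAlt) {u w : V} (huw : B u w = 1)
    (tu tw : (V →ₗ[ℚ] V)ˣ) (htu : ∀ v, ((tu : (V →ₗ[ℚ] V)ˣ) : V →ₗ[ℚ] V) v = v - B v u • u)
    (htw : ∀ v, ((tw : (V →ₗ[ℚ] V)ˣ) : V →ₗ[ℚ] V) v = v - B v w • w)
    (ε : V) (hb : ∃ b : ℤ, B u ε = b) (hc : ∃ c : ℤ, B w ε = c) :
    ∃ g ∈ Subgroup.closure ({tu, tw} : Set (V →ₗ[ℚ] V)ˣ), B u (((g : (V →ₗ[ℚ] V)ˣ) : V →ₗ[ℚ] V) ε) = 0 :=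
  -- LANDED p132127 (`…PlaneEuclid`)
  localTubeSpan_planeEuclid B hB huw tu tw htu htw ε hb hc

/-- stub (cycle 8, worker A2): **JANSSEN'S LEMMA 2.7** ([Schnell2010] §7, proof of Lemma 11: "V is
already generated by the smaller set Δ₁ = {δ ∈ Δ : ⟨δ₁, δ⟩ = 1 or δ = δ₁}"), UNCONDITIONALLY, granting
the pencil Euclid of A1 as a hypothesis: for a skew vanishing lattice and `u ∈ Δ`, the lattice `ℤΔ` is
generated by `u` and the partners of `u`.  (`M₁ :=` that span contains a partner `w`; for `ε ∈ Δ` with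
`⟨u, ε⟩ = 0`, `T_ε` maps partners to partners, so `T_ε M₁ ⊆ M₁`; a general `ε ∈ Δ` is `g⁻¹ ε'` with
`ε' = g ε ∈ Δ ∩ u^⊥`, `g ∈ ⟨T_u, T_w⟩` preserving `M₁`; so `M₁` is `Γ_Δ`-stable and contains
`Δ = Γ_Δ u`.) -/
theorem stub_partnersGenerate (B : LinearMap.BilinForm ℚ V) (hB : B.IsAlt) (Δ : Set V)
    (hΔ : IsSkewVanishingLattice B Δ)
    (heuclid : ∀ {u w : V}, B u w = 1 → ∀ (tu tw : (V →ₗ[ℚ] V)ˣ),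
      (∀ v, ((tu : (V →ₗ[ℚ] V)ˣ) : V →ₗ[ℚ] V) v = v - B v u • u) →
      (∀ v, ((tw : (V →ₗ[ℚ] V)ˣ) : V →ₗ[ℚ] V) v = v - B v w • w) →
      ∀ ε : V, (∃ b : ℤ, B u ε = b) → (∃ c : ℤ, B w ε = c) →
        ∃ g ∈ Subgroup.closure ({tu, tw} : Set (V →ₗ[ℚ] V)ˣ),
          B u (((g : (V →ₗ[ℚ] V)ˣ) : V →ₗ[ℚ] V) ε) = 0)
    {u : V} (hu : u ∈ Δ) :
    Submodule.span ℤ (insert u {δ ∈ Δ | B u δ = 1}) = Submodule.span ℤ Δ :=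
  -- LANDED p132223 (`…PartnersGenerate`)
  localTubeSpan_partnersGenerate B hB Δ hΔ heuclid hu

/-- stub (cycle 8, worker B): TRANSVECTION IDENTITIES of an alternating form (pointwise, no groups):
(i) `T_{kd+a} (T_{kd-a} v) = v - 2⟨v,a⟩a - 2k²⟨v,d⟩d` for `⟨d, a⟩ = 0`;
(ii) with `⟨u,w⟩ = 1`, `n ⟂ u, w`: the `-1` of the plane `(u, w)` (`v ↦ v - 2(⟨v,w⟩u - ⟨v,u⟩w)`)
after the `-1` of the plane `(u, w + n)` is the pair move `v ↦ v + 2(⟨v,u⟩n + ⟨v,n⟩u)`;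
(iii) the Heisenberg law along an isotropic `n`: for `c, c' ⟂ n` the maps
`h_{c,k} v = v + ⟨v,c⟩n + ⟨v,n⟩c + k⟨v,n⟩n` compose as `h_{c,k} ∘ h_{c',k'} = h_{c+c', k+k'+⟨c',c⟩}`. -/
theorem stub_transvectionIdentities (B : LinearMap.BilinForm ℚ V) (hB : B.IsAlt) :
    (∀ (d a : V), B d a = 0 → ∀ (k : ℤ) (v : V),
      skewTransvection B ((k : ℚ) • d + a) (skewTransvection B ((k : ℚ) • d - a) v) =
        v - (2 : ℚ) • (B v a • a) - (2 * (k : ℚ) ^ 2) • (B v d • d)) ∧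
    (∀ (u w n : V), B u w = 1 → B u n = 0 → B w n = 0 → ∀ v : V,
      (v - (2 : ℚ) • (B v (w + n) • u - B v u • (w + n))) -
          (2 : ℚ) • (B (v - (2 : ℚ) • (B v (w + n) • u - B v u • (w + n))) w • u -
            B (v - (2 : ℚ) • (B v (w + n) • u - B v u • (w + n))) u • w) =
        v + (2 : ℚ) • (B v u • n + B v n • u)) ∧
    (∀ (n c c' : V) (k k' : ℚ), B c n = 0 → B c' n = 0 → ∀ v : V,
      (fun x => x + B x c • n + B x n • c + k • (B x n • n))
          ((fun x => x + B x c' • n + B x n • c' + k' • (B x n • n)) v) =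
        v + B v (c + c') • n + B v n • (c + c') + (k + k' + B c' c) • (B v n • n)) :=
  -- LANDED p132061 (`…TransvectionIdentities`)
  localTubeSpan_transvectionIdentities B hB

/-- stub (cycle 8, worker C): PAIR MOVES ALONG A UNIMODULAR VECTOR, granting Lemma 2.7 at `u`.  For a
skew vanishing lattice, a unimodular pair `u, w ∈ Δ` (`⟨u, w⟩ = 1`) and EVERY lattice vector `m ⟂ u`,
some element of `Γ_Δ` acts as `E_{u,m}² : v ↦ v + 2(⟨v,u⟩m + ⟨v,m⟩u)`.  (For `n ⟂ u, w` with
`w + n ∈ Δ`: the product of the six squares `T_u²T_w²T_{u+w}² · T_u²T_{w+n}²T_{u+w+n}²` — the `-1`'s of the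
planes `(u,w)` and `(u,w+n)` — acts as `E_{u,n}²`; such `n`, i.e. the `N`-components
`δ - ⟨δ,w⟩u - w` of the partners `δ` of `u`, generate the `N`-components of all of `ℤΔ` by Lemma 2.7;
the Heisenberg law `E_{u,2m}E_{u,2m'} = E_{u,2(m+m')}T_u^{4⟨m',m⟩}` and `E_{u,2ku} = T_u^{-4k}` close up.) -/
theorem stub_pairMovesOfPartners (B : LinearMap.BilinForm ℚ V) (hB : B.IsAlt) (Δ : Set V)
    (hΔ : IsSkewVanishingLattice B Δ) {u w : V} (hu : u ∈ Δ) (hw : w ∈ Δ) (huw : B u w = 1)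
    (hgen : Submodule.span ℤ (insert u {δ ∈ Δ | B u δ = 1}) = Submodule.span ℤ Δ)
    {m : V} (hm : m ∈ Submodule.span ℤ Δ) (hum : B u m = 0) :
    ∃ g ∈ transvectionGroup B Δ, ∀ v : V,
      ((g : (V →ₗ[ℚ] V)ˣ) : V →ₗ[ℚ] V) v = v + (2 : ℚ) • (B v u • m + B v m • u) :=
  -- LANDED p132229 (`…PairMoves`)
  localTubeSpan_pairMoves_of_partnersGenerate B hB Δ hΔ hu hw huw hgen hm hum

/-- stub (cycle 8, worker D): UNIMODULAR TRANSITIVITY WITH LOCAL HYPOTHESES — cycle 7's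
`localTubeSpan_unimodularTransitivity` verbatim, except that the pair moves are required only at
`e ∈ {x, y}` and the square moves only at `a ∈ {x, y, x + y}` (every use in its proof is of this form:
`E_{y,z}²`, `E_{y,w₁}²`, `E_{x,sw₁}²`; `T_x^{2k}`, `T_y^{2k}`, the word `T_x²T_y²T_{x+y}²`). -/
theorem stub_unimodularTransitivityLocal (B : LinearMap.BilinForm ℚ V) (hB : B.IsAlt) (Δ : Set V)
    (hint : ∀ δ ∈ Δ, ∀ δ' ∈ Δ, ∃ n : ℤ, B δ δ' = n)
    (Γ : Subgroup (V →ₗ[ℚ] V)ˣ) {x y : V} (hx : x ∈ Submodule.span ℤ Δ)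
    (hy : y ∈ Submodule.span ℤ Δ) (hxy : B x y = 1)
    (hpair : ∀ e ∈ ({x, y} : Set V), ∀ f ∈ Submodule.span ℤ Δ, B e f = 0 →
      ∃ g ∈ Γ, ∀ v : V, ((g : (V →ₗ[ℚ] V)ˣ) : V →ₗ[ℚ] V) v = v + (2 : ℚ) • (B v e • f + B v f • e))
    (hsq : ∀ a ∈ ({x, y, x + y} : Set V), ∃ g ∈ Γ, ∀ v : V,
        ((g : (V →ₗ[ℚ] V)ˣ) : V →ₗ[ℚ] V) v = v - (2 : ℚ) • (B v a • a))
    {t : V} (ht : ∃ z ∈ Submodule.span ℤ Δ, t = x + (2 : ℚ) • z)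
    (htu : ∃ y' ∈ Submodule.span ℤ Δ, B t y' = 1) :
    ∃ g ∈ Γ, ((g : (V →ₗ[ℚ] V)ˣ) : V →ₗ[ℚ] V) x = t :=
  -- LANDED p132212 + p132887 (`…UnimodularTransitivityLocalLemmas`, `…UnimodularTransitivityLocal`)
  localTubeSpan_unimodularTransitivity_local B hB Δ hint Γ hx hy hxy hpair hsq ht htu

/-- stub (cycle 8, worker K): THE `Sp♯₂` CONDITIONS ARE A GROUP AND CONTAIN THE MOVES.  For the lattice
`ℤΔ` of a form `B`: the conjunction "isometry ∧ preserves `ℤΔ` ∧ inverse preserves `ℤΔ` ∧ Schnell's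
displayed condition `l(gx - x) = 2⟨v, x⟩`" (the four hypotheses of `Janssen1983_thm2_5` on a unit `g`) is
closed under products (`v_{gh} = h⁻¹ v_g + v_h`) and inverses (`v_{g⁻¹} = -g v_g`), and holds for any unit
acting as a square `T_a²` (`a ∈ ℤΔ`, `v = l(a) a`) or as a pair move `E_{e,f}²` (`e, f ∈ ℤΔ`, `⟨e,f⟩ = 0`,
`v = -(l f • e + l e • f)`), `B` alternating and integral on `Δ`. -/
theorem stub_sp2Closure (B : LinearMap.BilinForm ℚ V) (hB : B.IsAlt) (Δ : Set V)
    (hint : ∀ δ ∈ Δ, ∀ δ' ∈ Δ, ∃ n : ℤ, B δ δ' = n) :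
    let C : (V →ₗ[ℚ] V)ˣ → Prop := fun g =>
      (∀ x y : V, B ((g : V →ₗ[ℚ] V) x) ((g : V →ₗ[ℚ] V) y) = B x y) ∧
      (∀ x ∈ Submodule.span ℤ Δ, (g : V →ₗ[ℚ] V) x ∈ Submodule.span ℤ Δ) ∧
      (∀ x ∈ Submodule.span ℤ Δ, ((g⁻¹ : (V →ₗ[ℚ] V)ˣ) : V →ₗ[ℚ] V) x ∈ Submodule.span ℤ Δ) ∧
      (∀ l : V →ₗ[ℚ] ℚ, (∀ x ∈ Submodule.span ℤ Δ, ∃ z : ℤ, l x = z) →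
        ∃ v ∈ Submodule.span ℤ Δ, ∀ x ∈ Submodule.span ℤ Δ,
          l ((g : V →ₗ[ℚ] V) x - x) = 2 * B v x)
    (∀ g h, C g → C h → C (g * h)) ∧ (∀ g, C g → C g⁻¹) ∧ C 1 ∧
    (∀ a ∈ Submodule.span ℤ Δ, ∀ g : (V →ₗ[ℚ] V)ˣ,
      (∀ v, (g : V →ₗ[ℚ] V) v = v - (2 : ℚ) • (B v a • a)) → C g) ∧
    (∀ e ∈ Submodule.span ℤ Δ, ∀ f ∈ Submodule.span ℤ Δ, B e f = 0 → ∀ g : (V →ₗ[ℚ] V)ˣ,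
      (∀ v, (g : V →ₗ[ℚ] V) v = v + (2 : ℚ) • (B v e • f + B v f • e)) → C g) := by
  -- LANDED p132166 (`…Sp2Closure`)
  intro C
  exact ⟨fun g h hg hh => localTubeSpan_sp2Cond_mul B Δ g h hg.1 hg.2.1 hg.2.2.1 hg.2.2.2 hh.1 hh.2.1
      hh.2.2.1 hh.2.2.2,
    fun g hg => localTubeSpan_sp2Cond_inv B Δ g hg.1 hg.2.1 hg.2.2.1 hg.2.2.2,
    localTubeSpan_sp2Cond_one B Δ,
    fun a ha g hg => localTubeSpan_sp2Cond_of_sqMove B Δ hB hint ha g hg,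
    fun e he f hf hef g hg => localTubeSpan_sp2Cond_of_pairMove B Δ hB hint he hf hef g hg⟩

/-- stub (cycle 8, worker P): SQUARES ALONG DIFFERENCES OF ORTHOGONAL PARTNERS.  For a skew vanishing
lattice, `u ∈ Δ` and two partners `δ, δ' ∈ Δ` of `u` (`⟨u, δ⟩ = ⟨u, δ'⟩ = 1`) with `⟨δ, δ'⟩ = 0`, some
element of `Γ_Δ` acts as `T_{δ'-δ}² : v ↦ v - 2⟨v, δ'-δ⟩(δ'-δ)`.  (Four-letter identity
`T_{w+n} T_w⁻¹ T_{w-n} T_w⁻¹ = T_n²` for `w ⟂ n` (`w = δ`, `n = δ' - δ`), where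
`w - n = 2δ - δ' = ∓(T_u²T_δ²T_{u+δ}²) δ'` lies in `Δ` up to the sign absorbed by `T_{-x} = T_x`.) -/
theorem stub_orthogonalPartnersSquare (B : LinearMap.BilinForm ℚ V) (hB : B.IsAlt) (Δ : Set V)
    (hΔ : IsSkewVanishingLattice B Δ) {u δ δ' : V} (hu : u ∈ Δ) (hδ : δ ∈ Δ) (hδ' : δ' ∈ Δ)
    (huδ : B u δ = 1) (huδ' : B u δ' = 1) (hδδ' : B δ δ' = 0) :
    ∃ g ∈ transvectionGroup B Δ, ∀ v : V,
      ((g : (V →ₗ[ℚ] V)ˣ) : V →ₗ[ℚ] V) v = v - (2 : ℚ) • (B v (δ' - δ) • (δ' - δ)) :=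
  -- LANDED p132192 (`…OrthogonalPartnersSquare`)
  localTubeSpan_orthogonalPartnersSquare B hB Δ hΔ hu hδ hδ' huδ huδ' hδδ'


/-- stub (cycle 8, LEAD — THE HARDEST, open in general): THE RESIDUAL.  For a skew vanishing lattice
with unimodular pair `u, w ∈ Δ`, a unit satisfying the four `Sp♯₂` conditions and FIXING `u` and `w`
(so `= id_P ⊕ γ` with `γ ∈ Sp♯₂(N)`, `N = ⟨u,w⟩^⊥ ∩ ℤΔ`) lies in `Γ_Δ`.  Known: `B|_N = 0` ⇒ `g = 1`;
`N/rad N` unimodular ⇒ equivalent to `T_m² ∈ Γ_Δ` for all `m ∈ N`; non-unimodular `N` needs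
non-unipotent stabiliser elements (`work/compute/schreier_fixP.py`: for `N` a `3`-plane the stabiliser
contains `T_{e-f}` and elements whose images in the `(2,3,6)` triangle group are translations by `6ℤ[ω]`,
consistent with `⊇ Γ(6)`). -/
theorem stub_residual [FiniteDimensional ℚ V] (B : LinearMap.BilinForm ℚ V) (hB : B.IsAlt)
    (Δ : Set V) (hΔ : IsSkewVanishingLattice B Δ) {u w : V} (hu : u ∈ Δ) (hw : w ∈ Δ)
    (huw : B u w = 1) (g : (V →ₗ[ℚ] V)ˣ)
    (h1 : ∀ x y : V, B ((g : V →ₗ[ℚ] V) x) ((g : V →ₗ[ℚ] V) y) = B x y)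
    (h2 : ∀ x ∈ Submodule.span ℤ Δ, (g : V →ₗ[ℚ] V) x ∈ Submodule.span ℤ Δ)
    (h3 : ∀ x ∈ Submodule.span ℤ Δ, ((g⁻¹ : (V →ₗ[ℚ] V)ˣ) : V →ₗ[ℚ] V) x ∈ Submodule.span ℤ Δ)
    (h4 : ∀ l : V →ₗ[ℚ] ℚ, (∀ x ∈ Submodule.span ℤ Δ, ∃ z : ℤ, l x = z) →
      ∃ v ∈ Submodule.span ℤ Δ, ∀ x ∈ Submodule.span ℤ Δ, l ((g : V →ₗ[ℚ] V) x - x) = 2 * B v x)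
    (hgu : (g : V →ₗ[ℚ] V) u = u) (hgw : (g : V →ₗ[ℚ] V) w = w) :
    g ∈ transvectionGroup B Δ := by
  sorry

/-! ### Compositions -/

/-- The unit of `GL(V)` underlying `T_δ` (`B` alternating). -/
theorem c8_exists_unit_transvection (B : LinearMap.BilinForm ℚ V) (hB : B.IsAlt) (Δ : Set V)
    {δ : V} (hδ : δ ∈ Δ) :
    ∃ t ∈ transvectionGroup B Δ, ∀ v : V, ((t : (V →ₗ[ℚ] V)ˣ) : V →ₗ[ℚ] V) v = v - B v δ • δ :=
  ⟨LinearMap.GeneralLinearGroup.ofLinearEquiv (skewTransvectionEquiv B (hB.self_eq_zero δ)),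
    unit_skewTransvection_mem_transvectionGroup B hδ (hB.self_eq_zero δ),
    fun v => by
      change skewTransvection B δ v = _
      exact skewTransvection_apply B δ v⟩

/-- Squares of transvections along elements of `Δ` are moves of `Γ_Δ`: some `g ∈ Γ_Δ` acts as
`v ↦ v - 2⟨v, δ⟩δ`. -/
theorem c8_exists_sqMove_of_mem (B : LinearMap.BilinForm ℚ V) (hB : B.IsAlt) (Δ : Set V)
    {δ : V} (hδ : δ ∈ Δ) :
    ∃ g ∈ transvectionGroup B Δ, ∀ v : V,
      ((g : (V →ₗ[ℚ] V)ˣ) : V →ₗ[ℚ] V) v = v - (2 : ℚ) • (B v δ • δ) := by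
  obtain ⟨t, ht, htv⟩ := c8_exists_unit_transvection B hB Δ hδ
  refine ⟨t * t, mul_mem ht ht, fun v => ?_⟩
  rw [Units.val_mul, Module.End.mul_apply, htv, htv, map_sub, map_smul, LinearMap.sub_apply,
    LinearMap.smul_apply, hB.self_eq_zero δ, smul_eq_mul, mul_zero, sub_zero]
  module

/-- For a unimodular pair `u, w ∈ Δ` (`⟨u, w⟩ = 1`): `u + w ∈ Δ` and `-w ∈ Δ` (`u + w = T_w⁻¹ u`,
`-w = T_u (T_w u)`). -/
theorem c8_add_mem_and_neg_mem_of_pair (B : LinearMap.BilinForm ℚ V) (hB : B.IsAlt) (Δ : Set V)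
    (hΔ : IsSkewVanishingLattice B Δ) {u w : V} (hu : u ∈ Δ) (hw : w ∈ Δ) (huw : B u w = 1) :
    u + w ∈ Δ ∧ -w ∈ Δ := by
  obtain ⟨tu, htu, htuv⟩ := c8_exists_unit_transvection B hB Δ hu
  obtain ⟨tw, htw, htwv⟩ := c8_exists_unit_transvection B hB Δ hw
  have hwu : B w u = -1 := by rw [← hB.neg_eq, huw]
  constructor
  · have h := hΔ.stable tw⁻¹ (inv_mem htw) u hu
    have e : ((tw⁻¹ : (V →ₗ[ℚ] V)ˣ) : V →ₗ[ℚ] V) u = u + w := by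
      have h1 : ((tw : (V →ₗ[ℚ] V)ˣ) : V →ₗ[ℚ] V) (u + w) = u := by
        rw [htwv, map_add, LinearMap.add_apply, huw, hB.self_eq_zero w, add_zero, one_smul,
          add_sub_cancel_right]
      calc ((tw⁻¹ : (V →ₗ[ℚ] V)ˣ) : V →ₗ[ℚ] V) u
          = ((tw⁻¹ : (V →ₗ[ℚ] V)ˣ) : V →ₗ[ℚ] V) (((tw : (V →ₗ[ℚ] V)ˣ) : V →ₗ[ℚ] V) (u + w)) := by
            rw [h1]
        _ = u + w := localTubeSpan_units_inv_apply_apply tw _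
    rwa [e] at h
  · have h := hΔ.stable (tu * tw) (mul_mem htu htw) u hu
    have e : ((tu * tw : (V →ₗ[ℚ] V)ˣ) : V →ₗ[ℚ] V) u = -w := by
      rw [Units.val_mul, Module.End.mul_apply, htwv, huw, one_smul, htuv, map_sub,
        LinearMap.sub_apply, hB.self_eq_zero u, hwu]
      module
    rwa [e] at h

/-- The pair and square moves needed by local transitivity at a unimodular pair `x, y ∈ Δ`, supplied by
`stub_pairMovesOfPartners` (at `x`, and at `y` with partner `-x`) and the squares of `T_x, T_y, T_{x+y}`. -/
theorem c8_movesAtPair (B : LinearMap.BilinForm ℚ V) (hB : B.IsAlt) (Δ : Set V)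
    (hΔ : IsSkewVanishingLattice B Δ) {x y : V} (hx : x ∈ Δ) (hy : y ∈ Δ) (hxy : B x y = 1) :
    (∀ e ∈ ({x, y} : Set V), ∀ f ∈ Submodule.span ℤ Δ, B e f = 0 →
      ∃ g ∈ transvectionGroup B Δ, ∀ v : V,
        ((g : (V →ₗ[ℚ] V)ˣ) : V →ₗ[ℚ] V) v = v + (2 : ℚ) • (B v e • f + B v f • e)) ∧
    (∀ a ∈ ({x, y, x + y} : Set V), ∃ g ∈ transvectionGroup B Δ, ∀ v : V,
        ((g : (V →ₗ[ℚ] V)ˣ) : V →ₗ[ℚ] V) v = v - (2 : ℚ) • (B v a • a)) := by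
  have heu : ∀ {u w : V}, B u w = 1 → ∀ (tu tw : (V →ₗ[ℚ] V)ˣ),
      (∀ v, ((tu : (V →ₗ[ℚ] V)ˣ) : V →ₗ[ℚ] V) v = v - B v u • u) →
      (∀ v, ((tw : (V →ₗ[ℚ] V)ˣ) : V →ₗ[ℚ] V) v = v - B v w • w) →
      ∀ ε : V, (∃ b : ℤ, B u ε = b) → (∃ c : ℤ, B w ε = c) →
        ∃ g ∈ Subgroup.closure ({tu, tw} : Set (V →ₗ[ℚ] V)ˣ),
          B u (((g : (V →ₗ[ℚ] V)ˣ) : V →ₗ[ℚ] V) ε) = 0 :=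
    fun huw tu tw htu htw ε hb hc => stub_planeEuclid B hB huw tu tw htu htw ε hb hc
  -- `-x ∈ Δ` is a partner of `y`: `⟨y, -x⟩ = 1`
  obtain ⟨hxyΔ, hnegy⟩ := c8_add_mem_and_neg_mem_of_pair B hB Δ hΔ hx hy hxy
  have hyx : B y (-x) = 1 := by rw [map_neg, ← hB.neg_eq, neg_neg, hxy]
  have hnegx : -x ∈ Δ := by
    have hnegyx : B (-y) x = 1 := by rw [map_neg, LinearMap.neg_apply, ← hB.neg_eq, neg_neg, hxy]
    -- `-x = -(partner)` : apply the lemma to the pair `(-y, x)`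
    exact (c8_add_mem_and_neg_mem_of_pair B hB Δ hΔ hnegy hx hnegyx).2
  refine ⟨fun e he f hf hef => ?_, fun a ha => ?_⟩
  · simp only [Set.mem_insert_iff, Set.mem_singleton_iff] at he
    rcases he with rfl | rfl
    · exact stub_pairMovesOfPartners B hB Δ hΔ hx hy hxy
        (stub_partnersGenerate B hB Δ hΔ heu hx) hf hef
    · exact stub_pairMovesOfPartners B hB Δ hΔ hy hnegx hyx
        (stub_partnersGenerate B hB Δ hΔ heu hy) hf hef
  · simp only [Set.mem_insert_iff, Set.mem_singleton_iff] at ha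
    rcases ha with rfl | rfl | rfl
    · exact c8_exists_sqMove_of_mem B hB Δ hx
    · exact c8_exists_sqMove_of_mem B hB Δ hy
    · exact c8_exists_sqMove_of_mem B hB Δ hxyΔ


/-- stub (cycle 8, LEAD): DESCENT TO THE STABILISER OF A UNIMODULAR PAIR.  For a skew vanishing lattice
with unimodular pair `u, w ∈ Δ` and any unit `g` satisfying the four `Sp♯₂` conditions, there is `h`
in `Γ_Δ`, itself satisfying the four conditions, with `h⁻¹ g` fixing `u` and `w`.  (`g u` is unimodular
and `≡ u (mod 2ℤΔ)`, so reachable from `u` by the moves of C inside `Γ_Δ ⊓ Sp♯₂` (D with the local subgroup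
cut out by K); then `g w = w + 2βu + 2m`, `m ⟂ u, w`, is corrected by `T_u^{∓2β}` and `E_{u,∓m}²`.) -/
theorem stub_descent [FiniteDimensional ℚ V] (B : LinearMap.BilinForm ℚ V) (hB : B.IsAlt)
    (Δ : Set V) (hΔ : IsSkewVanishingLattice B Δ) {u w : V} (hu : u ∈ Δ) (hw : w ∈ Δ)
    (huw : B u w = 1) (g : (V →ₗ[ℚ] V)ˣ)
    (h1 : ∀ x y : V, B ((g : V →ₗ[ℚ] V) x) ((g : V →ₗ[ℚ] V) y) = B x y)
    (h2 : ∀ x ∈ Submodule.span ℤ Δ, (g : V →ₗ[ℚ] V) x ∈ Submodule.span ℤ Δ)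
    (h3 : ∀ x ∈ Submodule.span ℤ Δ, ((g⁻¹ : (V →ₗ[ℚ] V)ˣ) : V →ₗ[ℚ] V) x ∈ Submodule.span ℤ Δ)
    (h4 : ∀ l : V →ₗ[ℚ] ℚ, (∀ x ∈ Submodule.span ℤ Δ, ∃ z : ℤ, l x = z) →
      ∃ v ∈ Submodule.span ℤ Δ, ∀ x ∈ Submodule.span ℤ Δ, l ((g : V →ₗ[ℚ] V) x - x) = 2 * B v x) :
    ∃ h ∈ transvectionGroup B Δ,
      (∀ x y : V, B ((h : V →ₗ[ℚ] V) x) ((h : V →ₗ[ℚ] V) y) = B x y) ∧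
      (∀ x ∈ Submodule.span ℤ Δ, (h : V →ₗ[ℚ] V) x ∈ Submodule.span ℤ Δ) ∧
      (∀ x ∈ Submodule.span ℤ Δ, ((h⁻¹ : (V →ₗ[ℚ] V)ˣ) : V →ₗ[ℚ] V) x ∈ Submodule.span ℤ Δ) ∧
      (∀ l : V →ₗ[ℚ] ℚ, (∀ x ∈ Submodule.span ℤ Δ, ∃ z : ℤ, l x = z) →
        ∃ v ∈ Submodule.span ℤ Δ, ∀ x ∈ Submodule.span ℤ Δ, l ((h : V →ₗ[ℚ] V) x - x) = 2 * B v x) ∧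
      ((h⁻¹ * g : (V →ₗ[ℚ] V)ˣ) : V →ₗ[ℚ] V) u = u ∧ ((h⁻¹ * g : (V →ₗ[ℚ] V)ˣ) : V →ₗ[ℚ] V) w = w :=
  -- LANDED p133209 (`…Descent`: `localTubeSpan_descent`; lattice coordinates p132443 `…LatticeCoordinates`)
  localTubeSpan_descent B hB Δ hΔ hu hw huw g h1 h2 h3 h4

/-- COMPOSITION (cycle 8, headline 1): **JANSSEN'S THEOREM 2.9 HOLDS** — unconditionally.
(`⇒`: a partner `gδ₂`; `⇐`: local unimodular transitivity at the pair `(δ, gδ₂)` with the moves of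
`movesAtPair`, then `Γ_Δ`-stability of `Δ`.) -/
theorem janssen_thm2_9 : Janssen1983_thm2_9 := by
  intro W _ _ B hB Δ hΔ x hx
  constructor
  · intro hxΔ
    obtain ⟨δ₁, hδ₁, δ₂, hδ₂, h12⟩ := hΔ.exists_pair
    obtain ⟨g, hg, hgx⟩ := hΔ.transitive δ₁ hδ₁ x hxΔ
    refine ⟨⟨((g : (W →ₗ[ℚ] W)ˣ) : W →ₗ[ℚ] W) δ₂,
      localTubeSpan_transvectionGroup_map_span_int B hB Δ hΔ.integral hg (Submodule.subset_span hδ₂),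
      ?_⟩, x, hxΔ, 0, Submodule.zero_mem _, by rw [sub_self, smul_zero]⟩
    rw [← hgx, localTubeSpan_transvectionGroup_isometry B hB Δ hg, h12]
  · rintro ⟨⟨y', hy', hxy'⟩, δ, hδ, z, hz, hxδ⟩
    obtain ⟨δ₁, hδ₁, δ₂, hδ₂, h12⟩ := hΔ.exists_pair
    obtain ⟨g, hg, hgδ⟩ := hΔ.transitive δ₁ hδ₁ δ hδ
    set y := ((g : (W →ₗ[ℚ] W)ˣ) : W →ₗ[ℚ] W) δ₂ with hydef
    have hyΔ : y ∈ Δ := hΔ.stable g hg δ₂ hδ₂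
    have hδy : B δ y = 1 := by
      rw [hydef, ← hgδ, localTubeSpan_transvectionGroup_isometry B hB Δ hg, h12]
    have ht : ∃ z ∈ Submodule.span ℤ Δ, x = δ + (2 : ℚ) • z :=
      ⟨z, hz, by rw [two_smul, ← two_nsmul, ← hxδ, add_sub_cancel]⟩
    obtain ⟨hpair, hsq⟩ := c8_movesAtPair B hB Δ hΔ hδ hyΔ hδy
    obtain ⟨g', hg', hg'δ⟩ := stub_unimodularTransitivityLocal B hB Δ hΔ.integral
      (transvectionGroup B Δ) (Submodule.subset_span hδ) (Submodule.subset_span hyΔ) hδy hpair hsq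
      ht ⟨y', hy', hxy'⟩
    rw [← hg'δ]
    exact hΔ.stable g' hg' δ hδ

/-- COMPOSITION (cycle 8, headline 2): **JANSSEN'S THEOREM 2.5 FROM ITS RESIDUAL** (descent at the pair
`(δ₁, δ₂)` of the definition, then the residual for the stabiliser element). -/
theorem janssen_thm2_5_of_residual
    (hres : ∀ (W : Type) [AddCommGroup W] [Module ℚ W] [FiniteDimensional ℚ W]
      (B : LinearMap.BilinForm ℚ W), B.IsAlt → ∀ Δ : Set W, IsSkewVanishingLattice B Δ →
      ∀ ⦃u w : W⦄, u ∈ Δ → w ∈ Δ → B u w = 1 → ∀ g : (W →ₗ[ℚ] W)ˣ,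
        (∀ x y : W, B ((g : W →ₗ[ℚ] W) x) ((g : W →ₗ[ℚ] W) y) = B x y) →
        (∀ x ∈ Submodule.span ℤ Δ, (g : W →ₗ[ℚ] W) x ∈ Submodule.span ℤ Δ) →
        (∀ x ∈ Submodule.span ℤ Δ, ((g⁻¹ : (W →ₗ[ℚ] W)ˣ) : W →ₗ[ℚ] W) x ∈ Submodule.span ℤ Δ) →
        (∀ l : W →ₗ[ℚ] ℚ, (∀ x ∈ Submodule.span ℤ Δ, ∃ z : ℤ, l x = z) →
          ∃ v ∈ Submodule.span ℤ Δ, ∀ x ∈ Submodule.span ℤ Δ,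
            l ((g : W →ₗ[ℚ] W) x - x) = 2 * B v x) →
        (g : W →ₗ[ℚ] W) u = u → (g : W →ₗ[ℚ] W) w = w → g ∈ transvectionGroup B Δ) :
    Janssen1983_thm2_5 := by
  intro W _ _ _ B hB Δ hΔ g h1 h2 h3 h4
  obtain ⟨u, hu, w, hw, huw⟩ := hΔ.exists_pair
  obtain ⟨h, hh, hh1, hh2, hh3, hh4, hgu, hgw⟩ := stub_descent B hB Δ hΔ hu hw huw g h1 h2 h3 h4
  obtain ⟨hmul, hinv, -, -, -⟩ := stub_sp2Closure B hB Δ hΔ.integral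
  have hC := hmul _ _ (hinv _ ⟨hh1, hh2, hh3, hh4⟩) ⟨h1, h2, h3, h4⟩
  have hmem : h⁻¹ * g ∈ transvectionGroup B Δ :=
    hres W B hB Δ hΔ hu hw huw (h⁻¹ * g) hC.1 hC.2.1 hC.2.2.1 hC.2.2.2 hgu hgw
  simpa using mul_mem hh hmem

/-- COMPOSITION (cycle 8): Janssen's Theorem 2.5 outright, once the residual stub is closed. -/
theorem janssen_thm2_5 : Janssen1983_thm2_5 :=
  janssen_thm2_5_of_residual fun _ _ _ _ B hB Δ hΔ _ _ hu hw huw g h1 h2 h3 h4 hgu hgw =>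
    stub_residual B hB Δ hΔ hu hw huw g h1 h2 h3 h4 hgu hgw

/-- COMPOSITION (cycle 8): the cycle-7 consequences now UNCONDITIONAL — the companions of Theorem 2.9
(`IsSkewVanishingLattice.add_two_smul_mem`) need no named fact. -/
example {W : Type} [AddCommGroup W] [Module ℚ W] {B : LinearMap.BilinForm ℚ W} (hB : B.IsAlt)
    {Δ : Set W} (hΔ : IsSkewVanishingLattice B Δ) {δ β : W} (hδ : δ ∈ Δ)
    (hβ : β ∈ Submodule.span ℤ Δ) (hβrad : ∀ x ∈ Δ, B β x = 0) : δ + 2 • β ∈ Δ :=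
  hΔ.add_two_smul_mem janssen_thm2_9 hB hδ hβ hβrad

end Cycle8Janssen


/-! ## Cycle 9 (lead c7) — ALL SQUARES ARE MONODROMY (Part A), and THEOREM U: Janssen's Theorem 2.5 for
lattices unimodular modulo the radical

Cycle 8 left Theorem 2.5 = descent + RESIDUAL.  Cycle 9 proves the residual for every skew vanishing lattice
whose lattice `ℤΔ` is UNIMODULAR MODULO ITS RADICAL (all curve-singularity lattices; global vanishing
lattices with unimodular vanishing cohomology), in two type-free steps:

* PART A — `T_a² ∈ Γ_Δ` for EVERY `a ∈ ℤΔ` (`stub_squares_all`).  With `𝒯₂ := {x : some g ∈ Γ_Δ acts as T_x²}`: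
  STEP (`stub_squares_step`): for `δ ∈ Δ ⟂ x`, `x ∈ 𝒯₂ ↔ x + δ ∈ 𝒯₂` (`T²_{x+δ} = T_x² T_δ² E_{δ,x}^{-2}`, the pair move
  at `δ` by cycle 8); STRIP (`stub_squares_strip`): the `⟨u,w⟩`-part of `x` is `g·p₀` with `p₀` primitive, and
  primitive vectors of the plane lie in `Δ` (`stub_primitive_mem`), so `x ∈ 𝒯₂ ↔ x_N ∈ 𝒯₂`; PEEL
  (`stub_squares_peel`): for `m ∈ N` and `n' ∈ N_w`, `δ := -u + ⟨m,n'⟩w + n' = T_w^{⟨m,n'⟩}(T_w⁻¹T_u⁻¹(w + n')) ∈ Δ`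
  is orthogonal to `-u + m`, whence `m ∈ 𝒯₂ ↔ m - n' ∈ 𝒯₂`; and `N` is generated by `N_w` (Lemma 2.7).  Verified
  numerically (`work/compute/t2_closure.py`: the closure covers every lattice vector, for chains `A₄,A₅,A₆` and
  random stars, unimodular or not).  Hence ALL level-2 pair moves `E_{e,f}² = T_e²T_f²T_{e+f}^{-2}` lie in `Γ_Δ`
  (`stub_threeSquares`), cycle 7's global transitivity hypotheses hold in `Γ_Δ`, and `E(ℤΔ) ⊆ Γ_Δ`.
* THEOREM U (`stub_theoremU`, lead) — for a full lattice `Λ` unimodular modulo its radical (`UNI⋆`: every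
  non-radical lattice vector is an integer multiple of a unimodular one plus a radical one) and ANY group `G`
  containing a unit acting as `T_a²` for each `a ∈ Λ`, every unit satisfying the four `Sp♯₂(Λ)` conditions lies
  in `G` (multi-plane descent: cycle 8's descent along successive orthogonal unimodular planes, the moves along
  the `j`-th plane taken inside `G ∩ Fix(P₁,…,P_{j-1})`, transitivity applied to the sublattice
  `Λ ∩ (P₁ ⊕ ⋯ ⊕ P_{j-1})^⊥`; the chain ends inside the radical, where the element is the identity).
* COMPOSITION: `janssen_thm2_5_of_uniStar` — the conclusion of `Janssen1983_thm2_5` for every skew vanishing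
  lattice with `UNI⋆(ℤΔ)`.  The NON-unimodular residual keeps the β-pair transvections of cycle 8's notes.
-/

section Cycle9Squares

variable {V : Type} [AddCommGroup V] [Module ℚ V]

/-- stub (cycle 9, worker S0): THE SQUARE STEP.  For a skew vanishing lattice, `δ ∈ Δ` and a lattice vector
`x ⟂ δ`: some element of `Γ_Δ` acts as `T_x²` iff some element acts as `T_{x+δ}²`
(`T_{x+δ}² = T_x² ∘ T_δ² ∘ E_{δ,x}^{-2}`, all commuting; the pair move `E_{δ,x}²` lies in `Γ_Δ` by
`localTubeSpan_pairMoves` at `δ` with a partner `gδ₂`, and `T_δ² ∈ Γ_Δ`). -/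
theorem stub_squares_step (B : LinearMap.BilinForm ℚ V) (hB : B.IsAlt) (Δ : Set V)
    (hΔ : IsSkewVanishingLattice B Δ) {δ x : V} (hδ : δ ∈ Δ) (hx : x ∈ Submodule.span ℤ Δ)
    (hδx : B δ x = 0) :
    (∃ g ∈ transvectionGroup B Δ, ∀ v : V,
        ((g : (V →ₗ[ℚ] V)ˣ) : V →ₗ[ℚ] V) v = v - (2 : ℚ) • (B v x • x)) ↔
    (∃ g ∈ transvectionGroup B Δ, ∀ v : V,
        ((g : (V →ₗ[ℚ] V)ˣ) : V →ₗ[ℚ] V) v = v - (2 : ℚ) • (B v (x + δ) • (x + δ))) :=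
  -- LANDED p133212 (`…SquaresStep`)
  localTubeSpan_squares_step B hB Δ hΔ hδ hx hδx

/-- stub (cycle 9, worker S1): PRIMITIVE VECTORS OF A UNIMODULAR PLANE ARE VANISHING CYCLES.  For a skew
vanishing lattice, a unimodular pair `u, w ∈ Δ` and coprime integers `α, β`, the vector `αu + βw` lies in `Δ`
(Euclid in `⟨T_u, T_w⟩`: `localTubeSpan_planeEuclid` moves it to `±u` inside `Δ`; or Theorem 2.9). -/
theorem stub_primitive_mem (B : LinearMap.BilinForm ℚ V) (hB : B.IsAlt) (Δ : Set V)
    (hΔ : IsSkewVanishingLattice B Δ) {u w : V} (hu : u ∈ Δ) (hw : w ∈ Δ) (huw : B u w = 1)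
    (α β : ℤ) (hαβ : IsCoprime α β) : (α : ℚ) • u + (β : ℚ) • w ∈ Δ :=
  -- LANDED p133200 (`…PrimitiveMem`)
  localTubeSpan_primitive_mem B hB Δ hΔ hu hw huw α β hαβ

/-- stub (cycle 9, worker S2): STRIP THE PLANE PART.  For a unimodular pair `u, w ∈ Δ`, a lattice vector
`m ⟂ u, w` and any integers `α, β`: `T_m²` is realised in `Γ_Δ` iff `T_{αu+βw+m}²` is (`αu + βw = g·p₀` with
`p₀ ∈ Δ` primitive and `p₀ ⟂ (j p₀ + m)`: `g` square steps — the step and the primitive vectors granted as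
hypotheses, proved by S0, S1). -/
theorem stub_squares_strip (B : LinearMap.BilinForm ℚ V) (hB : B.IsAlt) (Δ : Set V)
    (_hΔ : IsSkewVanishingLattice B Δ) {u w : V} (_hu : u ∈ Δ) (_hw : w ∈ Δ) (_huw : B u w = 1)
    (hstep : ∀ δ ∈ Δ, ∀ x ∈ Submodule.span ℤ Δ, B δ x = 0 →
      ((∃ g ∈ transvectionGroup B Δ, ∀ v : V,
          ((g : (V →ₗ[ℚ] V)ˣ) : V →ₗ[ℚ] V) v = v - (2 : ℚ) • (B v x • x)) ↔
       (∃ g ∈ transvectionGroup B Δ, ∀ v : V,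
          ((g : (V →ₗ[ℚ] V)ˣ) : V →ₗ[ℚ] V) v = v - (2 : ℚ) • (B v (x + δ) • (x + δ)))))
    (hprim : ∀ α β : ℤ, IsCoprime α β → (α : ℚ) • u + (β : ℚ) • w ∈ Δ)
    {m : V} (hm : m ∈ Submodule.span ℤ Δ) (hum : B u m = 0) (hwm : B w m = 0) (α β : ℤ) :
    (∃ g ∈ transvectionGroup B Δ, ∀ v : V,
        ((g : (V →ₗ[ℚ] V)ˣ) : V →ₗ[ℚ] V) v = v - (2 : ℚ) • (B v m • m)) ↔
    (∃ g ∈ transvectionGroup B Δ, ∀ v : V,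
        ((g : (V →ₗ[ℚ] V)ˣ) : V →ₗ[ℚ] V) v =
          v - (2 : ℚ) • (B v ((α : ℚ) • u + (β : ℚ) • w + m) • ((α : ℚ) • u + (β : ℚ) • w + m))) :=
  -- LANDED p133264 (`…SquaresStrip`; `hΔ hu hw huw` unused there)
  localTubeSpan_squares_strip B hB Δ hstep hprim hm hum hwm α β

/-- stub (cycle 9, worker S3): PEEL ONE PARTNER COMPONENT.  For a unimodular pair `u, w ∈ Δ`, lattice vectors
`m, n' ⟂ u, w` with `w + n' ∈ Δ`: `T_m²` is realised in `Γ_Δ` iff `T_{m-n'}²` is.  (`c := ⟨m, n'⟩`;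
`δ := -u + c w + n' = T_w^c (T_w⁻¹ T_u⁻¹ (w + n')) ∈ Δ` and `⟨-u + m, δ⟩ = c - c = 0`, so by the square step
`-u + m ∈ 𝒯₂ ↔ -u + m - δ = -c w + (m - n') ∈ 𝒯₂`; strip the plane parts on both sides — step and strip granted as
hypotheses, proved by S0, S2.) -/
theorem stub_squares_peel (B : LinearMap.BilinForm ℚ V) (hB : B.IsAlt) (Δ : Set V)
    (hΔ : IsSkewVanishingLattice B Δ) {u w : V} (hu : u ∈ Δ) (hw : w ∈ Δ) (huw : B u w = 1)
    (hstep : ∀ δ ∈ Δ, ∀ x ∈ Submodule.span ℤ Δ, B δ x = 0 →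
      ((∃ g ∈ transvectionGroup B Δ, ∀ v : V,
          ((g : (V →ₗ[ℚ] V)ˣ) : V →ₗ[ℚ] V) v = v - (2 : ℚ) • (B v x • x)) ↔
       (∃ g ∈ transvectionGroup B Δ, ∀ v : V,
          ((g : (V →ₗ[ℚ] V)ˣ) : V →ₗ[ℚ] V) v = v - (2 : ℚ) • (B v (x + δ) • (x + δ)))))
    (hstrip : ∀ m ∈ Submodule.span ℤ Δ, B u m = 0 → B w m = 0 → ∀ α β : ℤ,
      ((∃ g ∈ transvectionGroup B Δ, ∀ v : V,
          ((g : (V →ₗ[ℚ] V)ˣ) : V →ₗ[ℚ] V) v = v - (2 : ℚ) • (B v m • m)) ↔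
       (∃ g ∈ transvectionGroup B Δ, ∀ v : V,
          ((g : (V →ₗ[ℚ] V)ˣ) : V →ₗ[ℚ] V) v =
            v - (2 : ℚ) • (B v ((α : ℚ) • u + (β : ℚ) • w + m) • ((α : ℚ) • u + (β : ℚ) • w + m)))))
    {m n' : V} (hm : m ∈ Submodule.span ℤ Δ) (hum : B u m = 0) (hwm : B w m = 0)
    (hn' : n' ∈ Submodule.span ℤ Δ) (hun' : B u n' = 0) (hwn' : B w n' = 0) (hwn'Δ : w + n' ∈ Δ) :
    (∃ g ∈ transvectionGroup B Δ, ∀ v : V,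
        ((g : (V →ₗ[ℚ] V)ˣ) : V →ₗ[ℚ] V) v = v - (2 : ℚ) • (B v m • m)) ↔
    (∃ g ∈ transvectionGroup B Δ, ∀ v : V,
        ((g : (V →ₗ[ℚ] V)ˣ) : V →ₗ[ℚ] V) v = v - (2 : ℚ) • (B v (m - n') • (m - n'))) :=
  -- LANDED p133233 (`…SquaresPeel`)
  localTubeSpan_squares_peel B hB Δ hΔ hu hw huw hstep hstrip hm hum hwm hn' hun' hwn' hwn'Δ

/-- stub (cycle 9, worker S5): THREE SQUARES MAKE A PAIR MOVE.  For `B` alternating and `⟨e, f⟩ = 0`: if units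
`ge, gf, gef` act as `T_e², T_f², T_{e+f}²` then `ge * gf * gef⁻¹` acts as `E_{e,f}² : v ↦ v + 2(⟨v,e⟩f + ⟨v,f⟩e)`. -/
theorem stub_threeSquares (B : LinearMap.BilinForm ℚ V) (hB : B.IsAlt) {e f : V} (hef : B e f = 0)
    (ge gf gef : (V →ₗ[ℚ] V)ˣ)
    (hge : ∀ v, (ge : V →ₗ[ℚ] V) v = v - (2 : ℚ) • (B v e • e))
    (hgf : ∀ v, (gf : V →ₗ[ℚ] V) v = v - (2 : ℚ) • (B v f • f))
    (hgef : ∀ v, (gef : V →ₗ[ℚ] V) v = v - (2 : ℚ) • (B v (e + f) • (e + f))) (v : V) :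
    ((ge * gf * gef⁻¹ : (V →ₗ[ℚ] V)ˣ) : V →ₗ[ℚ] V) v = v + (2 : ℚ) • (B v e • f + B v f • e) :=
  -- LANDED p133162 (`…ThreeSquares`)
  localTubeSpan_threeSquares B hB hef ge gf gef hge hgf hgef v

/-- stub (cycle 9, LEAD): ALL SQUARES ARE MONODROMY (Part A).  For a skew vanishing lattice and every lattice
vector `x ∈ ℤΔ`, some element of `Γ_Δ` acts as `T_x² : v ↦ v - 2⟨v,x⟩x` — no named fact.  (Strip to
`N = ⟨u,w⟩^⊥`; `N` is generated by `N_w = {n : w + n ∈ Δ}` (Lemma 2.7, the `N`-projection of the partners);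
peel the `N_w`-components one at a time.) -/
theorem stub_squares_all (B : LinearMap.BilinForm ℚ V) (hB : B.IsAlt) (Δ : Set V)
    (hΔ : IsSkewVanishingLattice B Δ) {x : V} (hx : x ∈ Submodule.span ℤ Δ) :
    ∃ g ∈ transvectionGroup B Δ, ∀ v : V,
      ((g : (V →ₗ[ℚ] V)ˣ) : V →ₗ[ℚ] V) v = v - (2 : ℚ) • (B v x • x) := by
  -- notation: `P y` = some element of `Γ_Δ` acts as `T_y²`
  let P : V → Prop := fun y => ∃ g ∈ transvectionGroup B Δ, ∀ v : V,
    ((g : (V →ₗ[ℚ] V)ˣ) : V →ₗ[ℚ] V) v = v - (2 : ℚ) • (B v y • y)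
  have hint := hΔ.integral
  have hP0 : P 0 := ⟨1, one_mem _, fun v => by
    rw [Units.val_one, Module.End.one_apply, map_zero, zero_smul, smul_zero, sub_zero]⟩
  -- a unimodular pair
  obtain ⟨u, hu, w, hw, huw⟩ := hΔ.exists_pair
  have hwu : B w u = -1 := by rw [← hB.neg_eq, huw]
  have huΛ : u ∈ Submodule.span ℤ Δ := Submodule.subset_span hu
  have hwΛ : w ∈ Submodule.span ℤ Δ := Submodule.subset_span hw
  -- the step, the primitive vectors, the strip, the peel
  have hstep : ∀ δ ∈ Δ, ∀ y ∈ Submodule.span ℤ Δ, B δ y = 0 → (P y ↔ P (y + δ)) :=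
    fun δ hδ y hy hδy => stub_squares_step B hB Δ hΔ hδ hy hδy
  have hprim : ∀ α β : ℤ, IsCoprime α β → (α : ℚ) • u + (β : ℚ) • w ∈ Δ :=
    fun α β h => stub_primitive_mem B hB Δ hΔ hu hw huw α β h
  have hstrip : ∀ m ∈ Submodule.span ℤ Δ, B u m = 0 → B w m = 0 → ∀ α β : ℤ,
      (P m ↔ P ((α : ℚ) • u + (β : ℚ) • w + m)) :=
    fun m hm hum hwm α β => stub_squares_strip B hB Δ hΔ hu hw huw hstep hprim hm hum hwm α β
  have hpeel : ∀ m ∈ Submodule.span ℤ Δ, B u m = 0 → B w m = 0 → ∀ n' ∈ Submodule.span ℤ Δ,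
      B u n' = 0 → B w n' = 0 → w + n' ∈ Δ → (P m ↔ P (m - n')) :=
    fun m hm hum hwm n' hn' hun' hwn' hwn'Δ =>
      stub_squares_peel B hB Δ hΔ hu hw huw hstep hstrip hm hum hwm hn' hun' hwn' hwn'Δ
  -- the `N`-projection `π y = y - ⟨y,w⟩u + ⟨y,u⟩w`
  let π : V →ₗ[ℚ] V := LinearMap.id - (B.flip w).smulRight u + (B.flip u).smulRight w
  have hπ : ∀ y, π y = y - B y w • u + B y u • w := fun y => rfl
  have hπu : ∀ y, B u (π y) = 0 := fun y => by
    rw [hπ, map_add, map_sub, map_smul, map_smul, hB.self_eq_zero u, huw, smul_eq_mul, smul_eq_mul,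
      mul_zero, sub_zero, mul_one, ← hB.neg_eq y u]
    ring
  have hπw : ∀ y, B w (π y) = 0 := fun y => by
    rw [hπ, map_add, map_sub, map_smul, map_smul, hB.self_eq_zero w, hwu, smul_eq_mul, smul_eq_mul,
      mul_zero, add_zero, ← hB.neg_eq y w]
    ring
  have hπmem : ∀ y ∈ Submodule.span ℤ Δ, π y ∈ Submodule.span ℤ Δ := fun y hy => by
    obtain ⟨a, ha⟩ := localTubeSpan_integral_span B Δ hint hy hwΛ
    obtain ⟨b, hb⟩ := localTubeSpan_integral_span B Δ hint hy huΛ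
    rw [hπ, ha, hb]
    exact Submodule.add_mem _ (Submodule.sub_mem _ hy (localTubeSpan_intCast_smul_mem Δ huΛ a))
      (localTubeSpan_intCast_smul_mem Δ hwΛ b)
  -- `Q y`: translating by `π y` does not change `P` on `N`
  let Q : V → Prop := fun y => ∀ m ∈ Submodule.span ℤ Δ, B u m = 0 → B w m = 0 → (P m ↔ P (m + π y))
  have hQadd : ∀ y y', π y ∈ Submodule.span ℤ Δ → Q y → Q y' → Q (y + y') := by
    intro y y' hyΛ hQy hQy' m hm hum hwm
    rw [map_add, ← add_assoc]
    exact (hQy m hm hum hwm).trans (hQy' (m + π y) (Submodule.add_mem _ hm hyΛ)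
      (by rw [map_add, hum, hπu, add_zero]) (by rw [map_add, hwm, hπw, add_zero]))
  have hQneg : ∀ y, π y ∈ Submodule.span ℤ Δ → Q y → Q (-y) := by
    intro y hyΛ hQy m hm hum hwm
    have h := hQy (m + π (-y)) (Submodule.add_mem _ hm (by rw [map_neg]; exact Submodule.neg_mem _ hyΛ))
      (by rw [map_add, hum, hπu, add_zero]) (by rw [map_add, hwm, hπw, add_zero])
    rw [map_neg, add_assoc, neg_add_cancel, add_zero] at h
    rw [map_neg]
    exact h.symm
  have hgen := stub_partnersGenerate B hB Δ hΔ
    (fun huw tu tw htu htw ε hb hc => stub_planeEuclid B hB huw tu tw htu htw ε hb hc) hu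
  have hsub : ∀ {y}, y ∈ Submodule.span ℤ (insert u {δ ∈ Δ | B u δ = 1}) → y ∈ Submodule.span ℤ Δ :=
    fun {y} hy => by rw [← hgen]; exact hy
  have hQ : ∀ y ∈ Submodule.span ℤ Δ, Q y := by
    intro y hy
    have hy' : y ∈ Submodule.span ℤ (insert u {δ ∈ Δ | B u δ = 1}) := by rw [hgen]; exact hy
    clear hy
    induction hy' using Submodule.span_induction with
    | mem y hy =>
      intro m hm hum hwm
      rcases Set.mem_insert_iff.1 hy with rfl | hy
      · -- `π u = 0`
        have : π y = 0 := by
          rw [hπ, hB.self_eq_zero y, huw, zero_smul, one_smul, add_zero, sub_self]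
        rw [this, add_zero]
      · -- a partner `δ`: `π δ = n_δ` with `w + n_δ ∈ Δ`
        obtain ⟨hyΔ, huy⟩ := hy
        have hyu : B y u = -1 := by rw [← hB.neg_eq, huy]
        have hyΛ : y ∈ Submodule.span ℤ Δ := Submodule.subset_span hyΔ
        obtain ⟨a, ha⟩ := localTubeSpan_integral_span B Δ hint hyΛ hwΛ
        have hn : π y = y - (a : ℚ) • u - w := by rw [hπ, ha, hyu]; module
        -- `w + π y = y - a u ∈ Δ` (a shear along `u`)
        have hwn : w + π y ∈ Δ := by
          obtain ⟨g, hg, hgv⟩ := localTubeSpan_pairMoves_shear_mem B hB Δ hu a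
          have := hΔ.stable g hg y hyΔ
          rw [hgv, hyu] at this
          have e : w + π y = y + (a : ℚ) • ((-1 : ℚ) • u) := by rw [hn]; module
          rwa [e]
        have hπyΛ := hπmem y hyΛ
        -- peel at `m + π y`
        have h := hpeel (m + π y) (Submodule.add_mem _ hm hπyΛ)
          (by rw [map_add, hum, hπu, add_zero]) (by rw [map_add, hwm, hπw, add_zero])
          (π y) hπyΛ (hπu y) (hπw y) hwn
        rw [add_sub_cancel_right] at h
        exact h.symm
    | zero => intro m hm hum hwm; rw [map_zero, add_zero]
    | add y y' hymem _ ihy ihy' => exact hQadd y y' (hπmem y (hsub hymem)) ihy ihy'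
    | smul k y hymem ih =>
      have hyΛ : π y ∈ Submodule.span ℤ Δ := hπmem y (hsub hymem)
      induction k using Int.induction_on with
      | zero => intro m hm hum hwm; rw [zero_smul, map_zero, add_zero]
      | succ n ihn =>
        rw [add_smul, one_smul]
        exact hQadd _ _ (by rw [map_zsmul]; exact Submodule.smul_mem _ _ hyΛ) ihn ih
      | pred n ihn =>
        rw [sub_smul, one_smul, sub_eq_add_neg]
        have hmem : π ((-(n : ℤ)) • y) ∈ Submodule.span ℤ Δ := by
          rw [neg_smul, map_neg, map_zsmul]
          exact Submodule.neg_mem _ (Submodule.smul_mem _ _ hyΛ)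
        exact hQadd _ _ hmem ihn (hQneg y hyΛ ih)
  -- conclusion: strip `x` to `π x`, then `Q x` at `m = 0`
  obtain ⟨a, ha⟩ := localTubeSpan_integral_span B Δ hint hx hwΛ
  obtain ⟨b, hb⟩ := localTubeSpan_integral_span B Δ hint hx huΛ
  have hxdec : x = (a : ℚ) • u + ((-b : ℤ) : ℚ) • w + π x := by
    rw [hπ, ha, hb]; push_cast; module
  have hPπ : P (π x) := by
    have h := hQ x hx 0 (Submodule.zero_mem _) (map_zero _) (map_zero _)
    rw [zero_add] at h
    exact h.1 hP0
  have h := (hstrip (π x) (hπmem x hx) (hπu x) (hπw x) a (-b)).1 hPπ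
  rw [← hxdec] at h
  exact h

/-- COMPOSITION (cycle 9): all level-2 pair moves are monodromy — cycle 7's GLOBAL hypotheses `hpair`, `hsq`
hold in `Γ_Δ` with no named fact (the conclusion of `localTubeSpan_sp2Elementary` without `h25`). -/
theorem sp2Elementary_holds (B : LinearMap.BilinForm ℚ V) (hB : B.IsAlt) (Δ : Set V)
    (hΔ : IsSkewVanishingLattice B Δ) :
    (∀ e ∈ Submodule.span ℤ Δ, ∀ f ∈ Submodule.span ℤ Δ, B e f = 0 →
      ∃ g ∈ transvectionGroup B Δ, ∀ x : V,
        ((g : (V →ₗ[ℚ] V)ˣ) : V →ₗ[ℚ] V) x = x + (2 : ℚ) • (B x e • f + B x f • e)) ∧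
    (∀ a ∈ Submodule.span ℤ Δ, ∃ g ∈ transvectionGroup B Δ, ∀ x : V,
        ((g : (V →ₗ[ℚ] V)ˣ) : V →ₗ[ℚ] V) x = x - (2 : ℚ) • (B x a • a)) := by
  refine ⟨fun e he f hf hef => ?_, fun a ha => stub_squares_all B hB Δ hΔ ha⟩
  obtain ⟨ge, hge, hgev⟩ := stub_squares_all B hB Δ hΔ he
  obtain ⟨gf, hgf, hgfv⟩ := stub_squares_all B hB Δ hΔ hf
  obtain ⟨gef, hgef, hgefv⟩ := stub_squares_all B hB Δ hΔ (Submodule.add_mem _ he hf)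
  exact ⟨ge * gf * gef⁻¹, mul_mem (mul_mem hge hgf) (inv_mem hgef),
    stub_threeSquares B hB hef ge gf gef hgev hgfv hgefv⟩

end Cycle9Squares

section Cycle9TheoremU

variable {V : Type} [AddCommGroup V] [Module ℚ V]

/-- stub (cycle 9, LEAD): **THEOREM U** — the level-2 congruence subgroup of a lattice unimodular modulo its
radical is generated by squares of transvections.  Let `Λ = ℤS` be a finitely generated lattice spanning `V`
on which the alternating form `B` is integral, with `UNI⋆`: every lattice vector pairing non-trivially with
`Λ` is `c • x₀ + r` with `x₀ ∈ Λ` unimodular (`⟨x₀, y⟩ = 1` for some `y ∈ Λ`), `c ∈ ℤ`, `r ∈ Λ` radical.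
If a subgroup `G ≤ GL(V)` contains, for each `a ∈ Λ`, a unit acting as `T_a²`, then every unit satisfying
the four `Sp♯₂(Λ)` conditions lies in `G`. -/
theorem stub_theoremU [FiniteDimensional ℚ V] (B : LinearMap.BilinForm ℚ V) (hB : B.IsAlt) (S : Set V)
    (hint : ∀ δ ∈ S, ∀ δ' ∈ S, ∃ n : ℤ, B δ δ' = n) (hfg : (Submodule.span ℤ S).FG)
    (hsp : Submodule.span ℚ S = ⊤)
    (huni : ∀ x ∈ Submodule.span ℤ S, (∃ y ∈ Submodule.span ℤ S, B x y ≠ 0) →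
      ∃ x₀ ∈ Submodule.span ℤ S, ∃ c : ℤ, ∃ r ∈ Submodule.span ℤ S,
        (∀ y ∈ Submodule.span ℤ S, B r y = 0) ∧ x = (c : ℚ) • x₀ + r ∧
        ∃ y ∈ Submodule.span ℤ S, B x₀ y = 1)
    (G : Subgroup (V →ₗ[ℚ] V)ˣ)
    (hsq : ∀ a ∈ Submodule.span ℤ S, ∃ g ∈ G, ∀ v : V,
      ((g : (V →ₗ[ℚ] V)ˣ) : V →ₗ[ℚ] V) v = v - (2 : ℚ) • (B v a • a))
    (g : (V →ₗ[ℚ] V)ˣ)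
    (h1 : ∀ x y : V, B ((g : V →ₗ[ℚ] V) x) ((g : V →ₗ[ℚ] V) y) = B x y)
    (h2 : ∀ x ∈ Submodule.span ℤ S, (g : V →ₗ[ℚ] V) x ∈ Submodule.span ℤ S)
    (h3 : ∀ x ∈ Submodule.span ℤ S, ((g⁻¹ : (V →ₗ[ℚ] V)ˣ) : V →ₗ[ℚ] V) x ∈ Submodule.span ℤ S)
    (h4 : ∀ l : V →ₗ[ℚ] ℚ, (∀ x ∈ Submodule.span ℤ S, ∃ z : ℤ, l x = z) →
      ∃ v ∈ Submodule.span ℤ S, ∀ x ∈ Submodule.span ℤ S, l ((g : V →ₗ[ℚ] V) x - x) = 2 * B v x) :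
    g ∈ G :=
  -- PROVED by the lead (cycle 9): `…TheoremUStep` (p133917) + `…TheoremU` (multi-plane descent).
  localTubeSpan_theoremU B hB S hint hfg hsp huni G hsq g h1 h2 h3 h4

/-- COMPOSITION (cycle 9): **the conclusion of Janssen's Theorem 2.5 for every skew vanishing lattice whose
lattice is unimodular modulo its radical** (Theorem U with `G = Γ_Δ` and the squares of Part A). -/
theorem janssen_thm2_5_of_uniStar [FiniteDimensional ℚ V] (B : LinearMap.BilinForm ℚ V) (hB : B.IsAlt)
    (Δ : Set V) (hΔ : IsSkewVanishingLattice B Δ)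
    (huni : ∀ x ∈ Submodule.span ℤ Δ, (∃ y ∈ Submodule.span ℤ Δ, B x y ≠ 0) →
      ∃ x₀ ∈ Submodule.span ℤ Δ, ∃ c : ℤ, ∃ r ∈ Submodule.span ℤ Δ,
        (∀ y ∈ Submodule.span ℤ Δ, B r y = 0) ∧ x = (c : ℚ) • x₀ + r ∧
        ∃ y ∈ Submodule.span ℤ Δ, B x₀ y = 1)
    (g : (V →ₗ[ℚ] V)ˣ)
    (h1 : ∀ x y : V, B ((g : V →ₗ[ℚ] V) x) ((g : V →ₗ[ℚ] V) y) = B x y)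
    (h2 : ∀ x ∈ Submodule.span ℤ Δ, (g : V →ₗ[ℚ] V) x ∈ Submodule.span ℤ Δ)
    (h3 : ∀ x ∈ Submodule.span ℤ Δ, ((g⁻¹ : (V →ₗ[ℚ] V)ˣ) : V →ₗ[ℚ] V) x ∈ Submodule.span ℤ Δ)
    (h4 : ∀ l : V →ₗ[ℚ] ℚ, (∀ x ∈ Submodule.span ℤ Δ, ∃ z : ℤ, l x = z) →
      ∃ v ∈ Submodule.span ℤ Δ, ∀ x ∈ Submodule.span ℤ Δ, l ((g : V →ₗ[ℚ] V) x - x) = 2 * B v x) :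
    g ∈ transvectionGroup B Δ :=
  stub_theoremU B hB Δ hΔ.integral hΔ.fg hΔ.span_eq_top huni (transvectionGroup B Δ)
    (fun _ ha => stub_squares_all B hB Δ hΔ ha) g h1 h2 h3 h4

end Cycle9TheoremU

section Cycle9Wave2

variable {V : Type} [AddCommGroup V] [Module ℚ V]

/-- stub (cycle 9 wave 2, worker W6): `UNI⋆` FROM UNIMODULARITY MODULO THE RADICAL.  If every `ℚ`-linear
functional integral on the lattice `Λ = ℤS` and vanishing on the radical vectors of `Λ` is `⟨v, ·⟩` on `Λ` for
some `v ∈ Λ` (the induced form on `Λ/rad` is unimodular), then every `x ∈ Λ` pairing non-trivially with `Λ` is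
`c • x₀ + r` with `x₀ ∈ Λ` unimodular, `c ∈ ℤ`, `r ∈ Λ` radical (`c` = the generator of the ideal `⟨x, Λ⟩ ⊆ ℤ`,
`x₀` represents the integral functional `⟨x, ·⟩/c`). -/
theorem stub_uniStar_of_unimodular (B : LinearMap.BilinForm ℚ V) (hB : B.IsAlt) (S : Set V)
    (hint : ∀ δ ∈ S, ∀ δ' ∈ S, ∃ n : ℤ, B δ δ' = n)
    (hunimod : ∀ l : V →ₗ[ℚ] ℚ, (∀ a ∈ Submodule.span ℤ S, ∃ z : ℤ, l a = z) →
      (∀ r ∈ Submodule.span ℤ S, (∀ y ∈ Submodule.span ℤ S, B r y = 0) → l r = 0) →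
      ∃ v ∈ Submodule.span ℤ S, ∀ a ∈ Submodule.span ℤ S, l a = B v a)
    {x : V} (hx : x ∈ Submodule.span ℤ S) (hxnr : ∃ y ∈ Submodule.span ℤ S, B x y ≠ 0) :
    ∃ x₀ ∈ Submodule.span ℤ S, ∃ c : ℤ, ∃ r ∈ Submodule.span ℤ S,
      (∀ y ∈ Submodule.span ℤ S, B r y = 0) ∧ x = (c : ℚ) • x₀ + r ∧
      ∃ y ∈ Submodule.span ℤ S, B x₀ y = 1 :=
  -- LANDED p133837 (`…UniStar`, worker W6)
  localTubeSpan_uniStar_of_unimodular B hB S hint hunimod hx hxnr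

/-- stub (cycle 9 wave 2, worker W4): THE ODD β-PAIR TRANSVECTION.  For a skew vanishing lattice, `u ∈ Δ` and
two partners `a, b ∈ Δ` of `u` (`⟨u,a⟩ = ⟨u,b⟩ = 1`) whose pairing `β = ⟨a,b⟩` is ODD, the transvection along the
(in general NON-unimodular) vector `a - b` is monodromy: some `g ∈ Γ_Δ` acts as `T_{a-b}`.  (In
`⟨T_u,T_a,T_b⟩ = H ⋊ SL₂(⟨u,a⟩)`, `H` the index-two Heisenberg group `{h_{c,k} : k ≡ q(c) mod 2}` along the
radical vector `r = a - b - βu` of `⟨u,a,b⟩`: `T_{a-b} = T_u^{β²} ∘ h_{-βu,-1}` and `(-βu,-1) ∈ H` iff `β` is odd;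
explicit word `T_u^{β²} · h · (s₁hs₁⁻¹) · sq^{-(1+β)/2}` with `h = T_bT_v⁻¹`, `v = a - βu`, `s₁ = zT_u^β`,
`z = T_u²T_a²T_{u+a}²`, `sq = (s₂hs₂⁻¹)(s₃hs₃⁻¹)`, `s₂ = T_aT_u^{β+1}`, `s₃ = zs₂`, verified in exact
arithmetic for `β ∈ {±1,±3,5,7}`, `work/compute/g3_formula.py` of lead c7.) -/
theorem stub_betaPairOdd (B : LinearMap.BilinForm ℚ V) (hB : B.IsAlt) (Δ : Set V)
    (hΔ : IsSkewVanishingLattice B Δ) {u a b : V} (hu : u ∈ Δ) (ha : a ∈ Δ) (hb : b ∈ Δ)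
    (hua : B u a = 1) (hub : B u b = 1) {β : ℤ} (hab : B a b = β) (hβ : Odd β) :
    ∃ g ∈ transvectionGroup B Δ, ∀ v : V,
      ((g : (V →ₗ[ℚ] V)ˣ) : V →ₗ[ℚ] V) v = v - B v (a - b) • (a - b) :=
  -- LANDED p134170 (`…BetaPairOdd`, worker W4)
  localTubeSpan_betaPairOdd B hB Δ hΔ hu ha hb hua hub hab hβ

/-- COMPOSITION (cycle 9 wave 2): Janssen's Theorem 2.5 — its conclusion, with no named fact — for every skew
vanishing lattice in a finite-dimensional space whose lattice is unimodular modulo its radical in the functional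
form. -/
theorem janssen_thm2_5_of_unimodular [FiniteDimensional ℚ V] (B : LinearMap.BilinForm ℚ V) (hB : B.IsAlt)
    (Δ : Set V) (hΔ : IsSkewVanishingLattice B Δ)
    (hunimod : ∀ l : V →ₗ[ℚ] ℚ, (∀ a ∈ Submodule.span ℤ Δ, ∃ z : ℤ, l a = z) →
      (∀ r ∈ Submodule.span ℤ Δ, (∀ y ∈ Submodule.span ℤ Δ, B r y = 0) → l r = 0) →
      ∃ v ∈ Submodule.span ℤ Δ, ∀ a ∈ Submodule.span ℤ Δ, l a = B v a)
    (g : (V →ₗ[ℚ] V)ˣ)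
    (h1 : ∀ x y : V, B ((g : V →ₗ[ℚ] V) x) ((g : V →ₗ[ℚ] V) y) = B x y)
    (h2 : ∀ x ∈ Submodule.span ℤ Δ, (g : V →ₗ[ℚ] V) x ∈ Submodule.span ℤ Δ)
    (h3 : ∀ x ∈ Submodule.span ℤ Δ, ((g⁻¹ : (V →ₗ[ℚ] V)ˣ) : V →ₗ[ℚ] V) x ∈ Submodule.span ℤ Δ)
    (h4 : ∀ l : V →ₗ[ℚ] ℚ, (∀ x ∈ Submodule.span ℤ Δ, ∃ z : ℤ, l x = z) →
      ∃ v ∈ Submodule.span ℤ Δ, ∀ x ∈ Submodule.span ℤ Δ, l ((g : V →ₗ[ℚ] V) x - x) = 2 * B v x) :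
    g ∈ transvectionGroup B Δ :=
  janssen_thm2_5_of_uniStar B hB Δ hΔ
    (fun _ hx hxnr => stub_uniStar_of_unimodular B hB Δ hΔ.integral hunimod hx hxnr) g h1 h2 h3 h4

end Cycle9Wave2

/-! ## Status after cycle 9 (lead c7, 2026-08-17)

LANDED (all `--supports stmt-HodgeConjecture-2490`, namespace `…Theorems`, files `LinearSystemTorelliLocalTubeSpan<Name>`):
Part A `…SquaresAll` (p133883: `localTubeSpan_squares_all`, `_sp2Elementary_holds`, `_unimodularTransitivity_holds`),
its four stubs `…SquaresStep` (p133212), `…PrimitiveMem` (p133200), `…SquaresStrip` (p133264), `…SquaresPeel` (p133233),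
`…ThreeSquares` (p133162); THEOREM U `…TheoremUStep` (p133917: `localTubeSpan_theoremU_step`) and `…TheoremU`
(p134437: `localTubeSpan_symplecticFamily_card_le`, `_theoremU_isotropicEnd`, `localTubeSpan_theoremU`,
`localTubeSpan_sp2_mem_of_uniStar`, `localTubeSpan_sp2_mem_of_unimodular`); wave 2 `…UniStar` (p133837,
`localTubeSpan_uniStar_of_unimodular`) and `…BetaPairOdd` (p134170, `localTubeSpan_betaPairOdd`: `T_{a-b} ∈ Γ_Δ` for
partners `a, b` of a common `u ∈ Δ` with `⟨a,b⟩` odd).  **Janssen's Theorem 2.5 is now a theorem of the tree for every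
skew vanishing lattice unimodular modulo its radical** (`localTubeSpan_sp2_mem_of_unimodular`), and Theorem 2.9 for all
(cycle 8).  The only `sorry` left in this skeleton is `stub_residual` in general.

THE GENERAL RESIDUAL (non-unimodular `N = ⟨u,w⟩^⊥ ∩ ℤΔ`) — analysis of cycle 9 (evidence `work/compute/hn_*.py`,
`d6_*.py` of the lead, attached to the item):
* `H_N := {γ : id_P ⊕ γ ∈ Γ_Δ}` must contain `Sp♯₂(N)`.  Let `S_u` be the image of `Stab_{Γ_Δ}(u)` in `Sp(u^⊥/u) = Sp(N)`
  and `κ̄ : Stab_{Γ_Δ}(u) → N/2N` the class of the `N`-component of `t w - w` (a crossed homomorphism).  The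
  Heisenberg elements `h^u_{c,k}` (`c ∈ 2N`) lie in `Γ_Δ` (pair moves), hence `H_N ⊇ image(ker κ̄)`, a subgroup of
  index `≤ 4` of `S_u`; numerically `κ̄` factors through `S_u` (no odd Heisenberg elements), i.e. `H_N = ker κ̄`.
* For `N` a `d`-plane (`⟨e,f⟩ = d`, `Sp♯₂(N) = Γ(2d)`): the transvections FIXING `u` only give `⟨⟨U^d⟩⟩ ⊉ Γ(2d)` once
  `genus X(d) > 0` (`d ≥ 6`) — a genuine obstruction for every "local" argument; but Schreier generators of
  `Stab(u)` of length `12` (e.g. `T_{w+e}T_u⁻¹T_wT_{w+f}T_u²T_{w+f}⁻²T_uT_{w+e}⁻¹T_w⁻²` for `d = 6`) act on `N`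
  HYPERBOLICALLY with non-zero image in `π₁(X(6)) = ℤ²`, and Stallings folding in `Γ(2)/±1 = F₂` PROVES, for the
  sampled finite generating sets: `d = 2,3,4,5`: squares + the level-2 differences `T_x⁻¹T_{x+2n}` (`u + x ∈ Δ`)
  already contain `Γ(2d)`; `d = 6`: `ker κ̄`-generators + squares contain `Γ(12)` (index 48 in `Γ(2)/±1`).  So
  Janssen's containment holds in these examples, and the mechanism is GLOBAL (u-moving words).
* What a proof needs: a rank-one EXTENSION STEP uniform in the elementary divisors (Janssen's own induction,
  paper requested: acq-05675 / acq-06585 (GDZ open scan), Chmutov 1983 acq-06586), or a transitivity statement on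
  TRIPLES `(u, w, w + n)`.
-/


/-! ## Cycle 10 (lead c7) — THEOREM U⁺: the unimodularity hypothesis REMOVED (Janssen 2.5 for every
nondegenerate skew vanishing lattice)

THE ASYMMETRIC ENGINE (found and verified numerically in cycle 9→10, `work/compute/asym_engine.py`,
`r_orbit.py`, `e_orbit.py`): let `L` be an integral lattice containing a unimodular pair `u, w`, let
`δ ∈ L ⟂ u, w`, and let `y` be ANY vector (typically NOT in `L`: a dual vector) with `y ⟂ u, w`,
`⟨y, δ⟩ = 1`, `⟨y, L⟩ ⊆ ℤ`.  Then the squares `T_a²` (`a ∈ L`) act TRANSITIVELY on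
`{t ∈ y + 2L : ⟨t, x⟩ = 1 for some x ∈ L}` — in at most FOUR moves: with `t = y + 2λ`, `α = ⟨λ,w⟩`,
`β = -⟨λ,u⟩`: (0) if `β = 0 ≠ α`, `T_w²`; (1) `T_{u + j m_x}²` with `m_x` the `P^⊥`-part of a partner `x`
of `t` and `j` a coprime shift, making `gcd(α, β) = 1`; (2) `T_{su + s'w + cδ}²` (`c ∈ {1,2}` by the parity
of `ν = ⟨y, λ⟩`, `s'α - sβ` prescribed by Bezout) making `⟨y, λ⟩ = ±1`; (3) `T_λ^{±2}`, which sends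
`y + 2λ ↦ y` exactly when `⟨y, λ⟩ = ±1`.  The plane `P = ⟨u,w⟩` is the catalyst: mixed vectors
`p + m` realise coefficient-`1` moves although `y` itself carries no moves (this is why `K ≠ E` for a bare
`d`-plane but `K = E` as soon as a unimodular plane is present).

THEOREM U⁺ (`stub_theoremUplus`, lead): for a lattice `Λ = ℤS` spanning the nondegenerate space `V`,
containing a unimodular pair, and ANY `G ∋` all squares `T_a²` (`a ∈ Λ`): `Sp♯₂(Λ) ⊆ G`.  Proof: a ℤ-basis
`b = (u, w, n₃, …, n_r)` of `Λ = P ⊕ N` with its `B`-dual basis `(y_i)` (`stub_adaptedBasis`); induction on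
`k`: every `g ∈ Sp♯₂(Λ)` fixing `{b₁..b_{k}}^⊥` lies in `G` — the step moves the dual vector `y_{k+1}` back
(`g y - y ∈ 2Λ_{k+1}` by `stub_dualMove`; asymmetric engine for `k ≥ 2`, the symmetric engine of cycle 7 for
`k = 1`, powers of `T_u²` for `k = 0`).  With Part A: **Janssen's Theorem 2.5 for every skew vanishing
lattice in a nondegenerate space** (`janssen_thm2_5_nondegenerate`), which is all that Schnell's Lemma 11
consumes (`…Lemma11OfStarBasis` applies 2.5 inside the nondegenerate quotient) — the line's last named
fact disappears.  (The degenerate case of the Literature fact: adapted basis through `rad ∩ Λ`, radical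
steps trivial — cycle 11.)
-/

section Cycle10

variable {V : Type} [AddCommGroup V] [Module ℚ V]

/-- stub (cycle 10, worker A): THE ASYMMETRIC ENGINE (≤ 4 squares). -/
theorem stub_asymEngine (B : LinearMap.BilinForm ℚ V) (hB : B.IsAlt) (S : Set V)
    (hint : ∀ δ ∈ S, ∀ δ' ∈ S, ∃ n : ℤ, B δ δ' = n)
    (G : Subgroup (V →ₗ[ℚ] V)ˣ)
    (hsq : ∀ a ∈ Submodule.span ℤ S, ∃ g ∈ G, ∀ v : V,
      ((g : (V →ₗ[ℚ] V)ˣ) : V →ₗ[ℚ] V) v = v - (2 : ℚ) • (B v a • a))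
    {u w δ : V} (hu : u ∈ Submodule.span ℤ S) (hw : w ∈ Submodule.span ℤ S)
    (hδ : δ ∈ Submodule.span ℤ S) (huw : B u w = 1) (hδu : B δ u = 0) (hδw : B δ w = 0)
    (y : V) (hyu : B y u = 0) (hyw : B y w = 0) (hyδ : B y δ = 1)
    (hyint : ∀ a ∈ Submodule.span ℤ S, ∃ z : ℤ, B y a = z)
    {t : V} (ht : ∃ c ∈ Submodule.span ℤ S, t = y + (2 : ℚ) • c)
    (htx : ∃ x ∈ Submodule.span ℤ S, B t x = 1) :
    ∃ g ∈ G, ((g : (V →ₗ[ℚ] V)ˣ) : V →ₗ[ℚ] V) t = y := by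
  sorry

/-- stub (cycle 10, worker A'): the coprime shift behind move (1) of the asymmetric engine. -/
theorem stub_coprimeShiftSub (α β κ c₁ c₂ c₃ : ℤ) (hrel : c₁ * κ + c₂ * α + c₃ * β = 1) (hβ : β ≠ 0) :
    ∃ j : ℤ, IsCoprime (α - j * κ) β := by
  sorry

/-- stub (cycle 10, worker C): A DUAL VECTOR MOVES BY `2Λ`.  For `y` pairing integrally with `Λ = ℤS`
(`Λ` finitely generated, spanning `V`) and a unit `g` preserving `Λ` with Schnell's displayed condition,
`g y - y ∈ 2Λ` (clear denominators: `N•y ∈ Λ`; apply the condition to `x = N•y` and every integral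
functional; `…LatticeCoordinates.localTubeSpan_exists_half_of_even`). -/
theorem stub_dualMove [FiniteDimensional ℚ V] (B : LinearMap.BilinForm ℚ V) (hB : B.IsAlt) (S : Set V)
    (hfg : (Submodule.span ℤ S).FG) (hsp : Submodule.span ℚ S = ⊤)
    (y : V) (hyint : ∀ a ∈ Submodule.span ℤ S, ∃ z : ℤ, B y a = z)
    (g : (V →ₗ[ℚ] V)ˣ) (h2 : ∀ x ∈ Submodule.span ℤ S, (g : V →ₗ[ℚ] V) x ∈ Submodule.span ℤ S)
    (h4 : ∀ l : V →ₗ[ℚ] ℚ, (∀ x ∈ Submodule.span ℤ S, ∃ z : ℤ, l x = z) →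
      ∃ v ∈ Submodule.span ℤ S, ∀ x ∈ Submodule.span ℤ S, l ((g : V →ₗ[ℚ] V) x - x) = 2 * B v x) :
    ∃ c ∈ Submodule.span ℤ S, (g : V →ₗ[ℚ] V) y = y + (2 : ℚ) • c := by
  sorry

/-- stub (cycle 10, worker D): AN ADAPTED ℤ-BASIS AND ITS DUAL.  For `Λ = ℤS` finitely generated and
spanning the finite-dimensional space `V`, `B` alternating, integral on `S` and NONDEGENERATE, and a
unimodular pair `u, w ∈ Λ`: a family `b = (u, w, n₃, …)` of lattice vectors with the `nᵢ ⟂ u, w`, such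
that every lattice vector is an INTEGER combination of the `b i`, together with the `B`-dual family
`⟨yv i, b j⟩ = δᵢⱼ` (`Λ = P ⊕ (Λ ∩ P^⊥)`, a ℤ-basis of the free module `Λ ∩ P^⊥`, `B.toDual`). -/
theorem stub_adaptedBasis [FiniteDimensional ℚ V] (B : LinearMap.BilinForm ℚ V) (hB : B.IsAlt)
    (hnd : B.Nondegenerate) (S : Set V) (hint : ∀ δ ∈ S, ∀ δ' ∈ S, ∃ n : ℤ, B δ δ' = n)
    (hfg : (Submodule.span ℤ S).FG) (hsp : Submodule.span ℚ S = ⊤)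
    {u w : V} (hu : u ∈ Submodule.span ℤ S) (hw : w ∈ Submodule.span ℤ S) (huw : B u w = 1) :
    ∃ (n : ℕ) (b yv : Fin (n + 2) → V), b 0 = u ∧ b 1 = w ∧ (∀ i, b i ∈ Submodule.span ℤ S) ∧
      (∀ i : Fin (n + 2), 2 ≤ (i : ℕ) → B (b i) u = 0 ∧ B (b i) w = 0) ∧
      (∀ x ∈ Submodule.span ℤ S, ∃ c : Fin (n + 2) → ℤ, x = ∑ i, ((c i : ℤ) : ℚ) • b i) ∧
      (∀ i j, B (yv i) (b j) = if i = j then 1 else 0) := by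
  sorry

/-- stub (cycle 10, LEAD): **THEOREM U⁺** — Theorem U without `UNI⋆`, for nondegenerate `B`. -/
theorem stub_theoremUplus [FiniteDimensional ℚ V] (B : LinearMap.BilinForm ℚ V) (hB : B.IsAlt)
    (hnd : B.Nondegenerate) (S : Set V) (hint : ∀ δ ∈ S, ∀ δ' ∈ S, ∃ n : ℤ, B δ δ' = n)
    (hfg : (Submodule.span ℤ S).FG) (hsp : Submodule.span ℚ S = ⊤)
    (hP : ∃ u ∈ Submodule.span ℤ S, ∃ w ∈ Submodule.span ℤ S, B u w = 1)
    (G : Subgroup (V →ₗ[ℚ] V)ˣ)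
    (hsq : ∀ a ∈ Submodule.span ℤ S, ∃ g ∈ G, ∀ v : V,
      ((g : (V →ₗ[ℚ] V)ˣ) : V →ₗ[ℚ] V) v = v - (2 : ℚ) • (B v a • a))
    (g : (V →ₗ[ℚ] V)ˣ)
    (h1 : ∀ x y : V, B ((g : V →ₗ[ℚ] V) x) ((g : V →ₗ[ℚ] V) y) = B x y)
    (h2 : ∀ x ∈ Submodule.span ℤ S, (g : V →ₗ[ℚ] V) x ∈ Submodule.span ℤ S)
    (h3 : ∀ x ∈ Submodule.span ℤ S, ((g⁻¹ : (V →ₗ[ℚ] V)ˣ) : V →ₗ[ℚ] V) x ∈ Submodule.span ℤ S)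
    (h4 : ∀ l : V →ₗ[ℚ] ℚ, (∀ x ∈ Submodule.span ℤ S, ∃ z : ℤ, l x = z) →
      ∃ v ∈ Submodule.span ℤ S, ∀ x ∈ Submodule.span ℤ S, l ((g : V →ₗ[ℚ] V) x - x) = 2 * B v x) :
    g ∈ G := by
  sorry

/-- COMPOSITION (cycle 10): **Janssen's Theorem 2.5 for every skew vanishing lattice in a NONDEGENERATE
space** — Theorem U⁺ with `G = Γ_Δ` and the squares of Part A.  No named fact, no unimodularity. -/
theorem janssen_thm2_5_nondegenerate [FiniteDimensional ℚ V] (B : LinearMap.BilinForm ℚ V)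
    (hB : B.IsAlt) (hnd : B.Nondegenerate) (Δ : Set V) (hΔ : IsSkewVanishingLattice B Δ)
    (g : (V →ₗ[ℚ] V)ˣ)
    (h1 : ∀ x y : V, B ((g : V →ₗ[ℚ] V) x) ((g : V →ₗ[ℚ] V) y) = B x y)
    (h2 : ∀ x ∈ Submodule.span ℤ Δ, (g : V →ₗ[ℚ] V) x ∈ Submodule.span ℤ Δ)
    (h3 : ∀ x ∈ Submodule.span ℤ Δ, ((g⁻¹ : (V →ₗ[ℚ] V)ˣ) : V →ₗ[ℚ] V) x ∈ Submodule.span ℤ Δ)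
    (h4 : ∀ l : V →ₗ[ℚ] ℚ, (∀ x ∈ Submodule.span ℤ Δ, ∃ z : ℤ, l x = z) →
      ∃ v ∈ Submodule.span ℤ Δ, ∀ x ∈ Submodule.span ℤ Δ, l ((g : V →ₗ[ℚ] V) x - x) = 2 * B v x) :
    g ∈ transvectionGroup B Δ := by
  obtain ⟨u, hu, w, hw, huw⟩ := hΔ.exists_pair
  exact stub_theoremUplus B hB hnd Δ hΔ.integral hΔ.fg hΔ.span_eq_top
    ⟨u, Submodule.subset_span hu, w, Submodule.subset_span hw, huw⟩ (transvectionGroup B Δ)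
    (fun _ ha => localTubeSpan_squares_all B hB Δ hΔ ha) g h1 h2 h3 h4

end Cycle10

end Summit.HodgeConjecture.HodgeConjecture.Cruxes.LocalTubeSpan.SketchJanssen

end
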